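import Summits.Ventures.DiscreteObjects.UnitDistance.AtlasResidueFieldsKernel
import Summits.Ventures.DiscreteObjects.UnitDistance.AtlasUpperSidesKernel
import Summits.Ventures.DiscreteObjects.UnitDistance.FiniteFieldLowerBoundF23
import Summits.Ventures.DiscreteObjects.UnitDistance.UnitQuadranceIndepSetF23
import Summits.Ventures.DiscreteObjects.UnitDistance.UnitQuadranceIndepSetF31
import Summits.Ventures.DiscreteObjects.UnitDistance.UnitQuadranceIndepSetF43
import Summits.Ventures.DiscreteObjects.UnitDistance.UnitQuadranceIndepSetF47
import HarnessLib

/-!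
# Every kernel row of the (U) residue-field atlas in one statement (state 2026-08-21, after seat udg g8)

Framing (verbatim for the cell): lottery ticket; floor = certified bounds/negative ranges.

`unitCircleGraph k` for the residue fields `k` with `|k| = q ≡ 3 (mod 4)` that Madore-type reduction can meet; 'killer' = `χ ≤ 5`.
KERNEL facts collected here (everything else in the census — `χ ≥ 6` at `p = 23, 31, 43, 47` by exact SDP certificates, `α(UD(F₂₇²)) ≤ 147`,
the rows `q = 343` and `q ≥ 67` — lives outside Lean):
* values: `χ(UD(F₃²)) = 3`, `χ(UD(F₇²)) = 4`, `χ(UD(F₁₁²)) = 5`, `χ(UD(F₁₉²)) = 5` (udg g2–g7);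
* `q = 27`: `5 ≤ χ ≤ 7` for every field with 27 elements (udg g6/g7);
* `q = 243`: `10 ≤ χ` for every field with 243 elements (udg g8, lines Hoffman bound);
* `p = 23`: `5 ≤ χ ≤ 7` (kernel search floor + explicit 7-colouring, udg g8); `p = 31, 43, 47`: `χ ≤ 8, 9, 11` (explicit colourings, udg g8);
* independence numbers: `87 ≤ α(UD(F₂₃²))`, `145 ≤ α(UD(F₃₁²))`, `228 ≤ α(UD(F₄₃²))`, `225 ≤ α(UD(F₄₇²))` (explicit sets, udg g8).
-/

namespace Summit.Ventures.DiscreteObjects.UnitDistance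

open SimpleGraph

/-- ALL KERNEL ROWS OF THE RESIDUE-FIELD ATLAS (chromatic numbers): exact values at 3, 7, 11, 19; `5 ≤ χ ≤ 7` at 27 and at 23;
`χ ≤ 8, 9, 11` at 31, 43, 47; `10 ≤ χ` at 243. -/
theorem atlas_rows_kernel :
    ((unitCircleGraph (ZMod 3)).chromaticNumber = 3 ∧ (unitCircleGraph (ZMod 7)).chromaticNumber = 4 ∧
      (unitCircleGraph (ZMod 11)).chromaticNumber = 5 ∧ (unitCircleGraph (ZMod 19)).chromaticNumber = 5) ∧
    (∀ (F : Type) [Field F] [Fintype F], Fintype.card F = 27 →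
        (5 : ℕ∞) ≤ (unitCircleGraph F).chromaticNumber ∧ (unitCircleGraph F).chromaticNumber ≤ 7) ∧
    (∀ (F : Type) [Field F] [Fintype F], Fintype.card F = 243 → (10 : ℕ∞) ≤ (unitCircleGraph F).chromaticNumber) ∧
    ((5 : ℕ∞) ≤ (unitCircleGraph (ZMod 23)).chromaticNumber ∧ (unitCircleGraph (ZMod 23)).chromaticNumber ≤ 7) ∧
    ((unitCircleGraph (ZMod 31)).chromaticNumber ≤ 8 ∧ (unitCircleGraph (ZMod 43)).chromaticNumber ≤ 9 ∧
      (unitCircleGraph (ZMod 47)).chromaticNumber ≤ 11) :=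
  ⟨⟨atlas_residue_fields_kernel.1, atlas_residue_fields_kernel.2.1, atlas_residue_fields_kernel.2.2.1,
      atlas_residue_fields_kernel.2.2.2.1⟩,
    atlas_residue_fields_kernel.2.2.2.2.1, atlas_residue_fields_kernel.2.2.2.2.2,
    ⟨five_le_chromaticNumber_unitCircleGraph_zmod23, atlas_upper_sides_kernel.1⟩, atlas_upper_sides_kernel.2⟩

/-- KERNEL INDEPENDENCE-NUMBER WITNESSES of the atlas: `87 ≤ α(UD(F₂₃²))`, `145 ≤ α(UD(F₃₁²))`, `228 ≤ α(UD(F₄₃²))`, `225 ≤ α(UD(F₄₇²))`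
(certified upper bounds outside Lean: 102, 192, 349, 435). -/
theorem atlas_indepNum_witnesses_kernel :
    87 ≤ (unitCircleGraph (ZMod 23)).indepNum ∧ 145 ≤ (unitCircleGraph (ZMod 31)).indepNum ∧
      228 ≤ (unitCircleGraph (ZMod 43)).indepNum ∧ 225 ≤ (unitCircleGraph (ZMod 47)).indepNum :=
  ⟨le_indepNum_unitCircleGraph_zmod23, le_indepNum_unitCircleGraph_zmod31, le_indepNum_unitCircleGraph_zmod43,
    le_indepNum_unitCircleGraph_zmod47⟩

end Summit.Ventures.DiscreteObjects.UnitDistance
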